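import Mathlib
import Summits.Ventures.HodgeRepro.OcticCMPointS3SignsExact
import Summits.Ventures.HodgeRepro.OcticCMPointGaloisRingE3

/-!
# OcticCMPointS3SignsInertTwo — the sign table of the octic point at `S₃` with the row `𝔮 | 2`, conductor `2`,
and the bridge to the chain's `E3At`

Blind re-derivation cell `pub-hodge-repro`, seat night-2 (gen 5).  Target tree path
`lean/Summits/Ventures/HodgeRepro/OcticCMPointS3SignsInertTwo.lean`.  Two things:

* **`S3_signs_exact_two`** — `OcticCMPointS3SignsExact.S3_signs_exact` (the five closed-form rows: `𝔮` conductor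
  `1`; `𝔭 | 5` conductors `1`, `2`, `3`, `4`) extended by the sixth row
  (vi) `𝔮 | 2`, conductor `2`: `ε(½, ω, ψ̃_δ) = ω(ϖ)^n` for EVERY character of `GR(4, 4)^× = (𝒪/𝔮²)^×` that is
  non-trivial on `1 + 2GR` and conjugate-dual (`OcticCMPointGaloisRingE3.eps_eq_piVal_pow_two`, `κ = 1/16`).
  At the inert place the unit part of a conjugate-dual character contributes nothing at conductor `1`
  (`OcticCMPointInertGauss`) and nothing at conductor `2`; both rows are the unramified shape of
  `GaussSumEvenConductor.LocalChar.eps_eq_piVal_pow_of_trivial`.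
* **`E3At_of_GR44`** — (E3) at a place `v ∈ S₃` of a face from the conductor-`2` inert model, by the chain's
  name: if the face's four local signs at `v` are the model's `ε(½, ω_j, ψ̃_δ)` for conjugate-dual `ω_j` of
  conductor exactly `2` with `π₀π₁ = π₂π₃` (the `ϖ`-part of N2 — nothing else), then `E3At I v d`
  (`PeriodCloserC7Stability.E3At_of_complex`); the identification `he` is the only input left, as in
  `OcticCMPointDualSign.E3At_of_tameWild`.

**What this is not.**  The four `χ′_j` of the octic face are on no page; `c ≥ 3` at `𝔮` and `c ≥ 5` at `𝔭 | 5` are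
not covered.  Nothing here says anything about the status of the Hodge conjecture for CM abelian varieties,
which is NOT proved.
-/

set_option autoImplicit false

noncomputable section

namespace Summit.Ventures.HodgeRepro.PeriodCloser

open GaussSumStability

/-- **The root numbers of the octic point at `S₃` in closed form, six rows**: the five of `S3_signs_exact` and
(vi) `𝔮 | 2`, conductor `2`: `ε(½, ω, ψ̃_δ) = ω(ϖ)^n` for every conjugate-dual `ω` of `GR(4, 4)` non-trivial on
`1 + 2GR`. -/
theorem S3_signs_exact_two (n : ℕ) :
    (∀ ω : LocalChar InertModel.F16, ω.unit ≠ 1 → (∀ x, ω.unit (InertModel.conj x) = ω.unit⁻¹ x) →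
        LocalChar.eps (1 / 4) n ω (InertModel.psiTilde InertModel.psi0) = ω.piVal ^ n) ∧
    (∀ π : ℂ, LocalChar.eps (((Real.sqrt 5)⁻¹ : ℝ) : ℂ) n (⟨TameModel.quadChar5, π⟩ : LocalChar (ZMod 5))
        TameModel.psi5 = π ^ n) ∧
    (∀ (ψ₀ : AddChar (ZMod 5) ℂ), ψ₀.IsPrimitive → ∀ (ω : LocalChar (DualNumber (ZMod 5))),
        (∃ z₀ ∈ DualModel.maxIdeal (ZMod 5), ω.unit (1 + z₀) ≠ 1) →
        (∀ x, ω.unit (DualModel.conj (ZMod 5) x) = ω.unit⁻¹ x) → ω.piVal ^ 2 = ω.unit (-1) →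
        Even n →
        ∃ θ : MulChar (ZMod 5) ℂ, ∃ β : ZMod 5, β ≠ 0 ∧ ω.unit = DualModel.tameWild θ β ψ₀ ∧ θ β * θ β = 1 ∧
          LocalChar.eps ((1 / 5 : ℝ) : ℂ) n ω (DualModel.psiTilde ψ₀) = ω.piVal ^ n * θ β) ∧
    (∀ π : ℂ, LocalChar.eps (((5 * Real.sqrt 5)⁻¹ : ℝ) : ℂ) n
        (⟨TruncModel.twist 3 (by norm_num) (by norm_num) (by decide) (by decide) 1 TameModel.psi5, π⟩ :
          LocalChar (TruncModel.Trunc (ZMod 5) 3)) (TruncModel.psiTilde 3 TameModel.psi5) = -π ^ n) ∧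
    (∀ (ψ₀ : AddChar (ZMod 5) ℂ), ψ₀.IsPrimitive → ∀ π : ℂ,
        LocalChar.eps ((1 / 25 : ℝ) : ℂ) n
          (⟨TruncModel.twist 4 (by norm_num) (by norm_num) (by decide) (by decide) 1 ψ₀, π⟩ :
            LocalChar (TruncModel.Trunc (ZMod 5) 4)) (TruncModel.psiTilde 4 ψ₀) = π ^ n) ∧
    (∀ ω : LocalChar GaloisRing.GR44, (∃ a, ω.unit (1 + 2 * a) ≠ 1) →
        (∀ x, ω.unit (GaloisRing.conjGR x) = ω.unit⁻¹ x) →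
        LocalChar.eps (1 / 16) n ω GaloisRing.psiTildeGR = ω.piVal ^ n) := by
  obtain ⟨h1, h2, h3, h4, h5⟩ := S3_signs_exact n
  exact ⟨h1, h2, h3, h4, h5, fun ω hc hσ => GaloisRing.eps_eq_piVal_pow_two ω hc hσ n⟩

open NumberField in
/-- **(E3) at a place of `S₃` of a face from the conductor-`2` inert model, by the chain's name**: if the face's
four local signs at `v` are the model's `ε(½, ω_j, ψ̃_δ)` for conjugate-dual `ω_j` of `GR(4, 4)` non-trivial on
`1 + 2GR` with `π₀π₁ = π₂π₃`, then `E3At I v d` — the identification `he` is the only input left. -/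
theorem E3At_of_GR44 {L : Type} [Field L] [NumberField L] [IsCMField L] (I : C7Face L) (v : I.Place)
    (d : I.Datum) (n : ℕ) (ω : Fin 4 → LocalChar GaloisRing.GR44) (hc : ∀ j, ∃ a, (ω j).unit (1 + 2 * a) ≠ 1)
    (hσ : ∀ j x, (ω j).unit (GaloisRing.conjGR x) = (ω j).unit⁻¹ x)
    (hN2 : (ω 0).piVal * (ω 1).piVal = (ω 2).piVal * (ω 3).piVal)
    (he : ∀ j, ((I.localRootNumber v (I.chars d j) : ℤ) : ℂ) =
      LocalChar.eps (1 / 16) n (ω j) GaloisRing.psiTildeGR) :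
    E3At I v d :=
  E3At_of_complex I v d (fun j => LocalChar.eps (1 / 16) n (ω j) GaloisRing.psiTildeGR) he
    (GaloisRing.E3_inert_two_exact ω hc hσ hN2 n)

end Summit.Ventures.HodgeRepro.PeriodCloser

end
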